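import Summits.QuantumFields.BalabanUV.Beta.FP.PolarizationGermBubble
import Summits.QuantumFields.BalabanUV.Beta.FP.BubbleSmearBridge
import Summits.QuantumFields.BalabanUV.Beta.FP.ExpLocalisedBubbleMarginals

/-!
# `BalabanUV.Beta.FP.PolarizationGermLegs` — road «FP» for binder row D1, leaf (H2), row **H2-ASM-3b** (the END of «KERNEL BUBBLE ⟹ GERM BUBBLE»), module 1 of 2
# (the 400-line cap): THE LEG REPLACEMENT — the engine's leading term as a function of two moment tables and six leg tables (`leadOf`), its KRONECKER COLLAPSE
# to FILE 1's `leadGerm` ∕ `leadGermSc` on continuum legs, the finite-algebra PERTURBATION ESTIMATE when the six leg tables are replaced, the FIELD-BLOCK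
# reduction of the one-loop bubble ∕ tadpole for a leg vanishing off the field block, and the TADPOLE size ([folklore]; nothing of the manuscripts)

HONEST DEPENDENCY (page 1, mandatory): continuum YM on T⁴ ⇐ BetaPertH ∧ nine spine estimates (0/9 proved); BetaPertH ⇐ (D1) ∧ (D4) ∧ CAP+tail;
G-an2-4 gates asym, D1 and NE2/3/4.  HONEST FRAMING (cell contract, verbatim): «discharging `BetaPertH` makes Bałaban's UV stability UNCONDITIONAL —
a real constructive-QFT result; it is NOT the continuum limit and NOT the Clay problem.»  THIS MODULE DISCHARGES NOTHING of the wall: finite algebra over a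
finite fibre and `Fin 4` ∕ `Fin 2`, triangle inequalities, and two appeals BY NAME to the H2-ASM-1 engine's landed bridge ∕ marginal bound
(`TadpoleSmearBridge.tadpole_eq_sum_smear`, `ExpLocalisedBubbleMarginals.abs_smear_le`); every analytic input is a HYPOTHESIS displayed in the signatures; two
[our object] data definitions (`fblk`, `leadOf`) that only NAME a restriction and an explicit finite sum; 0 `def … : Prop`, nothing cited, 0 sorry; 0∕4 row-D1
binders; NOT the row's END proper (module 2 `FP/PolarizationGerm`, after the engine's part D `ExpLocalisedBubbleKernel`), NOT `hgerm`, NOT D1, NOT BetaPertH, NOT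
continuum, NOT Clay.

ABSOLUTE RULE (cell charter, verbatim): «No internally-minted statement may enter as a cited fact. Every hypothesis is either kernel-proved in this package or a
verbatim quotation of a PUBLISHED theorem with page reference. The manuscript(s) under audit are NOT citable for their own disputed steps — they are the thing
under adjudication; programme-internal (2001/route/tribunal) claims are never citable.»

THE ROW (owner memo `HOME/b2b-balaban-beta-d1-p3/H2V-DESIGN.md` f78878bd5f8d2d18 §4; owner split l.25851: H2-ASM-3a = FILE 1 `FP/PolarizationGermBubble` ✓ p246050,
H2-ASM-3b = the END `|−½·bubble Pker (V μ 0)(V ν z) + ½·leadGerm cL (cubicGermOf V) μ ν (toReal z)| ≤ C″∕(‖z‖∞+1)⁷` + ghost twin + tadpole under (W-loc), E-FP-8-1).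
The engine (beta-d1-formalise-leaf-02, part D) delivers `|bubble A V₀ V₁ − Σ_{a f g h} Lead_{afgh}(z)| ≤ |Φ|⁴·KR∕(‖z‖∞+1)^{a+b+3}` with `Lead` a finite sum of [moment]·[moment]·[leg
value or difference at z]·[leg value or difference at z].  THIS MODULE is everything between that and FILE 1's germ identity that does NOT need part D's bytes:
* §1 [our object + folklore] `fblk K` (the field–field block of a packed-fibre kernel as a kernel on the fibre `Fin 4`), **`bubble_eq_fblk`** ∕ **`tadpole_eq_fblk`**: for a leg
  whose blocks touching a multiplier index vanish (`PerfectPolarization.Pker_inl_inr` ∕ `_inr_inl` ∕ `_inr_inr`) every fibre index of the cyclic trace sits on a leg, so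
  `bubble A V₀ V₁ = bubble (fblk A) (fblk V₀) (fblk V₁)` (finite `Fintype.sum_sum_type` bookkeeping inside the tsums); `fblk_shiftK`, `biLoc_fblk`.
* §2 [our object + folklore] **`leadOf m₀ m₁ P Q dF dG ddF ddG`** := `Σ_{a f g h} −Σ_{i j}[m₀ g f i 0·m₁ h a j 1·(Q f h·ddF i j a g) + m₀ g f i 0·m₁ h a j 0·(dF i a g·dG j f h)
  + m₀ g f i 1·m₁ h a j 1·(dF j a g·dG i f h) + m₀ g f i 1·m₁ h a j 0·(P a g·ddG i j f h)]` — LITERALLY the engine's `Σ Lead` with the four moment tsums and the six leg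
  values∕differences abstracted into tables (finite fibre `Φ`); `sum_kron₂` (double Kronecker collapse over `Fin 4`); **`leadOf_kron_eq_leadGerm`**: on the CONTINUUM tables
  `P⁰ a g = δ_{ag}·cL·ℓ₀(x)`, `dF⁰ i a g = δ_{ag}·cL·∂_iℓ₀(x)`, `ddF⁰ i j a g = δ_{ag}·cL·∂_i∂_jℓ₀(x)` (`BubbleTransfer.invSq ∕ d1InvSq ∕ hessInvSq`; same for `Q⁰ dG⁰ ddG⁰` in `(f,h)`)
  and the GERM moment tables `m₀ g f κ i = L g f μ κ i`, `m₁ h a κ i = L h a ν κ i` (FILE 1 §1's dictionary), `leadOf = leadGerm cL L μ ν x`; **`leadOf_unit_eq_leadGermSc`**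
  (fibre `Unit`, no Kronecker: `= leadGermSc cG l μ ν x`).
* §3 [folklore] THE PERTURBATION ESTIMATE **`abs_leadOf_sub_leadOf_le`**: moment tables bounded by `Mb`, lattice leg tables by `p0 q0 p1 q1 p2 q2`, their distances to any
  other six tables by `e0 f0 e1 f1 e2 f2` ⟹ `|leadOf(lattice) − leadOf(other)| ≤ |Φ|⁴·16·Mb²·[(f0·p2 + f0·e2 + q0·e2) + 2·(e1·q1 + e1·f1 + p1·f1) + (e0·q2 + e0·f2 + p0·f2)]`
  (product rule `abs_mul_sub_mul_le₃` with LATTICE sizes only: `|XY − X⁰Y⁰| ≤ |X−X⁰|·|Y| + |X−X⁰|·|Y−Y⁰| + |X|·|Y−Y⁰|`, so no size letter on the continuum legs is needed).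
  With the graded letters at `z` (`p0 ~ A₀∕N²`, `p1 ~ A₁∕N³`, `p2 ~ A₂∕N⁴`, dictionary `e0 ~ D₀∕N³`, `e1 ~ D₁∕N⁴`, `e2 ~ D₂∕N⁵`, `N = ‖z‖∞+1`) every product is `O(N⁻⁷)` — module 2.
* §4 [folklore] **`abs_tadpole_le`**: `|A| ≤ CA`, `A` translation invariant, `BiLoc W₂ 0 z Cw δ`, `δ > 0` ⟹ `|tadpole A W₂| ≤ |Φ|²·(Cw·Θ δ 0·CA)`; under the quartic table's
  joint-localisation letter (W-loc) `BiLoc (W μ 0 ν z) 0 z (Cw·e^{−δ|z|₁}) δ` (ERRATUM E-FP-8-1 to H2V-DESIGN §2, located by this seat: a z-free `Cw` gives only `O(1)` against a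
  power-law leg) this is the tadpole's exponential smallness in the bond separation.
WHAT IT IS NOT: no `Pker`, no remainder of the engine, no assembly — module 2 `FP/PolarizationGerm` composes part D BY NAME with §1–§3 and FILE 1 into the row's END for an
ABSTRACT leg with displayed graded∕dictionary letters (the `Pker` instance = H2-ASM-2 + H2-P-KER, plugged by H2-ASM-5).
Provenance: G-an2-4 formalisation swarm seat b2b-balaban-gan24-formalise-leaf-02 gen 39 (cross-lane on road FP; row H2-ASM-3b, owner GO journal l.25851), 2026-08-21.
-/

noncomputable section

namespace Summit.QuantumFields.BalabanUV.Beta.FP.PolarizationGermLegs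

open Finset
open scoped BigOperators
open Literature.MathematicalPhysics.QuantumFieldTheory.Balaban1983to89
open Literature.MathematicalPhysics.QuantumFieldTheory.Balaban1983to89.Beta
open Literature.MathematicalPhysics.QuantumFieldTheory.Balaban1983to89.Beta.TransverseStructure
open Literature.MathematicalPhysics.QuantumFieldTheory.Balaban1983to89.Beta.BubbleTransfer
open B12Sec2to5 (l1 l1_nonneg)
open ExpKernelCalculus (Site MKer Zl Zl_pos BiLoc comp tr bubble tadpole shiftK)
open OneStepResolventKernel (Fib)
open DyadicShell (Pt supNorm)
open Summit.QuantumFields.BalabanUV.Beta.FP.MarginalUniqueness (Idx CubicGerm δ Anti12)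
open Summit.QuantumFields.BalabanUV.Beta.FP.BubbleGermValue (sum_δ_mul sum_δ_mul' bubble bubbleCrossed ghostLoop ghostGerm bfGerm)
open Summit.QuantumFields.BalabanUV.Beta.FP.PolarizationGermBubble (leadGerm leadGermSc sum_comm₄)
open Summit.QuantumFields.BalabanUV.Beta.FP.ExpLocalisedBubbleOrder2Point (Θ Θ_nonneg)
open Summit.QuantumFields.BalabanUV.Beta.FP.ExpLocalisedBubbleMarginals (abs_smear_le)
open Summit.QuantumFields.BalabanUV.Beta.FP.TadpoleSmearBridge (loc_vertex₂ tadpole_eq_sum_smear)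

/-! ## §1 Field-block reduction: a leg vanishing off the field block sees only the field blocks of the vertices -/

section FieldBlock

/-- [our object] the FIELD–FIELD BLOCK of a packed-fibre kernel on `ℤ⁴`, as a kernel on the pure field fibre `Fin 4`. -/
def fblk (K : MKer 4 (Fib 3)) : MKer 4 (Fin 4) := fun x y a b => K x y (Sum.inl a) (Sum.inl b)

/-- [our object] entries of `fblk`. -/
@[simp] theorem fblk_apply (K : MKer 4 (Fib 3)) (x y : Site 4) (a b : Fin 4) : fblk K x y a b = K x y (Sum.inl a) (Sum.inl b) := rfl

variable {A : MKer 4 (Fib 3)}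

/-- [folklore] **BUBBLE = FIELD-BLOCK BUBBLE** for a leg whose blocks touching a multiplier index vanish (`Pker_inl_inr` ∕ `_inr_inl` ∕ `_inr_inr`): every fibre index of the
cyclic trace sits on a leg, so `bubble A V₀ V₁ = bubble (fblk A) (fblk V₀) (fblk V₁)`. -/
theorem bubble_eq_fblk (hio : ∀ x y α m, A x y (Sum.inl α) (Sum.inr m) = 0) (hoi : ∀ x y m α, A x y (Sum.inr m) (Sum.inl α) = 0)
    (hoo : ∀ x y m m', A x y (Sum.inr m) (Sum.inr m') = 0) (V₀ V₁ : MKer 4 (Fib 3)) :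
    bubble A V₀ V₁ = bubble (fblk A) (fblk V₀) (fblk V₁) := by
  unfold ExpKernelCalculus.bubble tr comp
  simp [Fintype.sum_sum_type, hio, hoi, hoo, fblk]

/-- [folklore] **TADPOLE = FIELD-BLOCK TADPOLE** for such a leg. -/
theorem tadpole_eq_fblk (hio : ∀ x y α m, A x y (Sum.inl α) (Sum.inr m) = 0) (hoi : ∀ x y m α, A x y (Sum.inr m) (Sum.inl α) = 0)
    (hoo : ∀ x y m m', A x y (Sum.inr m) (Sum.inr m') = 0) (W₂ : MKer 4 (Fib 3)) :
    tadpole A W₂ = tadpole (fblk A) (fblk W₂) := by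
  unfold ExpKernelCalculus.tadpole tr comp
  simp [Fintype.sum_sum_type, hio, hoi, hoo, fblk]

/-- [folklore] `fblk` commutes with simultaneous shifts. -/
theorem fblk_shiftK (v : Site 4) (K : MKer 4 (Fib 3)) : fblk (shiftK v K) = shiftK v (fblk K) := rfl

/-- [folklore] a bi-localised kernel has a bi-localised field block (same constants). -/
theorem biLoc_fblk {K : MKer 4 (Fib 3)} {p q : Site 4} {C δ' : ℝ} (hK : BiLoc K p q C δ') : BiLoc (fblk K) p q C δ' :=
  fun x y a b => hK x y (Sum.inl a) (Sum.inl b)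

end FieldBlock

/-! ## §2 The leading term as a function of the two moment tables and the six leg tables; the Kronecker collapse to `leadGerm` -/

section Lead

/-- [our object] **THE LEADING TERM OVER TABLES** (finite fibre `Φ`; `Φ = Fin 4` for the gluon sector, `Unit` for the ghost): moment tables `m₀ m₁ : Φ → Φ → Idx → Fin 2 → ℝ` (`m₀ g f κ 0∕1` = first∕second-slot moments of
the vertex at the origin, `m₁ h a κ 1∕0` = the recentred first∕second-slot moments of the vertex at `z` — the engine's `M₁¹ ↦ index 1`, `M₁² ↦ index 0`, cf. FILE 1 §1), leg
tables `P a g` (= `F_{ag}(z)`), `Q f h` (= `G_{fh}(z)`), `dF i a g`, `dG j f h`, `ddF i j a g`, `ddG i j f h` (first∕second differences at `z`):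
`Σ_{a f g h} −Σ_{i j} [m₀ g f i 0·m₁ h a j 1·(Q f h·ddF i j a g) + m₀ g f i 0·m₁ h a j 0·(dF i a g·dG j f h) + m₀ g f i 1·m₁ h a j 1·(dF j a g·dG i f h)
+ m₀ g f i 1·m₁ h a j 0·(P a g·ddG i j f h)]` — LITERALLY the engine's `Σ_{afgh} Lead_{afgh}` with its tsums and leg values abstracted.  A definition asserting nothing. -/
def leadOf {Φ : Type*} [Fintype Φ] (m₀ m₁ : Φ → Φ → Idx → Fin 2 → ℝ) (P Q : Φ → Φ → ℝ) (dF dG : Idx → Φ → Φ → ℝ)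
    (ddF ddG : Idx → Idx → Φ → Φ → ℝ) : ℝ :=
  ∑ a : Φ, ∑ f : Φ, ∑ g : Φ, ∑ h : Φ, -(∑ i : Idx, ∑ j : Idx,
    (m₀ g f i 0 * m₁ h a j 1 * (Q f h * ddF i j a g)
      + m₀ g f i 0 * m₁ h a j 0 * (dF i a g * dG j f h)
      + m₀ g f i 1 * m₁ h a j 1 * (dF j a g * dG i f h)
      + m₀ g f i 1 * m₁ h a j 0 * (P a g * ddG i j f h)))

/-- [folklore] **DOUBLE KRONECKER COLLAPSE** over the field fibre: `Σ_{a f g h} δ_{ag}·(δ_{fh}·Ψ a f g h) = Σ_{g h} Ψ g h g h`. -/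
theorem sum_kron₂ (Ψ : Fin 4 → Fin 4 → Fin 4 → Fin 4 → ℝ) :
    ∑ a : Fin 4, ∑ f : Fin 4, ∑ g : Fin 4, ∑ h : Fin 4, δ a g * (δ f h * Ψ a f g h) = ∑ g : Fin 4, ∑ h : Fin 4, Ψ g h g h := by
  rw [sum_comm₄ (fun a f g h => δ a g * (δ f h * Ψ a f g h))]
  refine Finset.sum_congr rfl fun g _ => Finset.sum_congr rfl fun h _ => ?_
  rw [show (∑ a : Fin 4, ∑ f : Fin 4, δ a g * (δ f h * Ψ a f g h)) = ∑ a : Fin 4, δ a g * ∑ f : Fin 4, δ f h * Ψ a f g h by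
    simp_rw [Finset.mul_sum]]
  simp_rw [sum_δ_mul]

/-- [folklore] **KRONECKER COLLAPSE TO THE GERM**: with the CONTINUUM leg tables `P⁰ a g = Q⁰ a g = δ_{ag}·cL·ℓ₀(x)`, `dF⁰ i a g = dG⁰ i a g = δ_{ag}·cL·∂_iℓ₀(x)`,
`ddF⁰ i j a g = ddG⁰ i j a g = δ_{ag}·cL·∂_i∂_jℓ₀(x)` and the GERM moment tables `m₀ g f κ i = L g f μ κ i`, `m₁ h a κ i = L h a ν κ i`, the leading term IS FILE 1's
`leadGerm cL L μ ν x`. -/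
theorem leadOf_kron_eq_leadGerm (cL : ℝ) (L : CubicGerm) (μ ν : Idx) (x : E4) :
    leadOf (fun g f κ i => L g f μ κ i) (fun h a κ i => L h a ν κ i)
        (fun a g => δ a g * (cL * invSq x)) (fun f h => δ f h * (cL * invSq x))
        (fun i a g => δ a g * (cL * d1InvSq i x)) (fun j f h => δ f h * (cL * d1InvSq j x))
        (fun i j a g => δ a g * (cL * hessInvSq i j x)) (fun i j f h => δ f h * (cL * hessInvSq i j x))
      = leadGerm cL L μ ν x := by
  unfold leadOf leadGerm
  -- factor the two Kroneckers out of each fibre term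
  have hfac : ∀ a f g h : Fin 4,
      -(∑ i : Idx, ∑ j : Idx,
        (L g f μ i 0 * L h a ν j 1 * ((δ f h * (cL * invSq x)) * (δ a g * (cL * hessInvSq i j x)))
          + L g f μ i 0 * L h a ν j 0 * ((δ a g * (cL * d1InvSq i x)) * (δ f h * (cL * d1InvSq j x)))
          + L g f μ i 1 * L h a ν j 1 * ((δ a g * (cL * d1InvSq j x)) * (δ f h * (cL * d1InvSq i x)))
          + L g f μ i 1 * L h a ν j 0 * ((δ a g * (cL * invSq x)) * (δ f h * (cL * hessInvSq i j x)))))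
        = δ a g * (δ f h * -(∑ i : Idx, ∑ j : Idx,
          (L g f μ i 0 * L h a ν j 1 * ((cL * invSq x) * (cL * hessInvSq i j x))
            + L g f μ i 0 * L h a ν j 0 * ((cL * d1InvSq i x) * (cL * d1InvSq j x))
            + L g f μ i 1 * L h a ν j 1 * ((cL * d1InvSq j x) * (cL * d1InvSq i x))
            + L g f μ i 1 * L h a ν j 0 * ((cL * invSq x) * (cL * hessInvSq i j x))))) := by
    intro a f g h
    rw [mul_neg, mul_neg, Finset.mul_sum, Finset.mul_sum]
    congr 1
    refine Finset.sum_congr rfl fun i _ => ?_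
    rw [Finset.mul_sum, Finset.mul_sum]
    refine Finset.sum_congr rfl fun j _ => ?_
    ring
  simp_rw [hfac]
  exact sum_kron₂ _

/-- [folklore] **SCALAR FIBRE** (`Φ = Unit`, no Kronecker): with the continuum leg tables `cG·ℓ₀(x)`, `cG·∂_iℓ₀(x)`, `cG·∂_i∂_jℓ₀(x)` and the germ moment tables
`m₀ () () κ i = l μ κ i`, `m₁ () () κ i = l ν κ i`, the leading term IS FILE 1's `leadGermSc cG l μ ν x`. -/
theorem leadOf_unit_eq_leadGermSc (cG : ℝ) (l : Idx → Idx → Fin 2 → ℝ) (μ ν : Idx) (x : E4) :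
    leadOf (fun (_ _ : Unit) κ i => l μ κ i) (fun (_ _ : Unit) κ i => l ν κ i)
        (fun _ _ => cG * invSq x) (fun _ _ => cG * invSq x)
        (fun i _ _ => cG * d1InvSq i x) (fun j _ _ => cG * d1InvSq j x)
        (fun i j _ _ => cG * hessInvSq i j x) (fun i j _ _ => cG * hessInvSq i j x)
      = leadGermSc cG l μ ν x := by
  unfold leadOf leadGermSc
  simp

end Lead

/-! ## §3 The leg replacement: perturbing the six leg tables inside the leading term -/

section Estimate

/-- [folklore] product perturbation with LATTICE sizes only: `|X·Y − X⁰·Y⁰| ≤ |X − X⁰|·|Y| + |X − X⁰|·|Y − Y⁰| + |X|·|Y − Y⁰|`. -/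
theorem abs_mul_sub_mul_le₃ (X Y X0 Y0 : ℝ) : |X * Y - X0 * Y0| ≤ |X - X0| * |Y| + |X - X0| * |Y - Y0| + |X| * |Y - Y0| := by
  have h : X * Y - X0 * Y0 = (X - X0) * Y + -((X - X0) * (Y - Y0)) + X * (Y - Y0) := by ring
  rw [h]
  refine (abs_add_le _ _).trans (add_le_add ((abs_add_le _ _).trans (le_of_eq ?_)) (le_of_eq (abs_mul _ _)))
  rw [abs_neg, abs_mul, abs_mul]

/-- [folklore] one product of the leading term: two moments times two legs, lattice vs continuum. -/
theorem abs_term_sub_le {m m' X Y X0 Y0 Mb bX bY eX eY : ℝ} (hm : |m| ≤ Mb) (hm' : |m'| ≤ Mb) (hX : |X| ≤ bX) (hY : |Y| ≤ bY)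
    (heX : |X - X0| ≤ eX) (heY : |Y - Y0| ≤ eY) :
    |m * m' * (X * Y) - m * m' * (X0 * Y0)| ≤ Mb ^ 2 * (eX * bY + eX * eY + bX * eY) := by
  rw [← mul_sub, abs_mul, abs_mul, sq]
  have h0 : 0 ≤ Mb := (abs_nonneg _).trans hm
  have h1 : 0 ≤ eX := (abs_nonneg _).trans heX
  have h2 : 0 ≤ eY := (abs_nonneg _).trans heY
  have h3 : 0 ≤ bX := (abs_nonneg _).trans hX
  have h4 : 0 ≤ bY := (abs_nonneg _).trans hY
  refine mul_le_mul (mul_le_mul hm hm' (abs_nonneg _) h0) ((abs_mul_sub_mul_le₃ X Y X0 Y0).trans ?_) (abs_nonneg _) (mul_nonneg h0 h0)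
  gcongr

/-- [folklore] finite-sum perturbation: termwise `|u − v| ≤ c` ⟹ `|Σu − Σv| ≤ #s·c`. -/
theorem abs_fsum_sub_fsum_le {ι : Type*} (s : Finset ι) {u v : ι → ℝ} {c : ℝ} (h : ∀ i ∈ s, |u i - v i| ≤ c) :
    |∑ i ∈ s, u i - ∑ i ∈ s, v i| ≤ s.card * c := by
  rw [← Finset.sum_sub_distrib]
  refine (Finset.abs_sum_le_sum_abs _ _).trans ?_
  calc ∑ i ∈ s, |u i - v i| ≤ ∑ _i ∈ s, c := Finset.sum_le_sum h
    _ = s.card * c := by rw [Finset.sum_const, nsmul_eq_mul]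

variable {Φ : Type*} [Fintype Φ] {m₀ m₁ : Φ → Φ → Idx → Fin 2 → ℝ} {P Q P0 Q0 : Φ → Φ → ℝ} {dF dG dF0 dG0 : Idx → Φ → Φ → ℝ}
  {ddF ddG ddF0 ddG0 : Idx → Idx → Φ → Φ → ℝ} {Mb p0 q0 p1 q1 p2 q2 e0 f0 e1 f1 e2 f2 : ℝ}

/-- [folklore] **THE LEG REPLACEMENT ESTIMATE** (pure finite algebra): if the moment tables are bounded by `Mb`, the six lattice leg tables by `p0 q0 p1 q1 p2 q2` and their
distances to six other ("continuum") tables by `e0 f0 e1 f1 e2 f2`, then the two leading terms differ by at most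
`|Φ|⁴·16·Mb²·[(f0·p2 + f0·e2 + q0·e2) + 2·(e1·q1 + e1·f1 + p1·f1) + (e0·q2 + e0·f2 + p0·f2)]` (`|Φ|⁴` fibre tuples, `4²` label pairs). -/
theorem abs_leadOf_sub_leadOf_le (hm₀ : ∀ g f κ i, |m₀ g f κ i| ≤ Mb) (hm₁ : ∀ h a κ i, |m₁ h a κ i| ≤ Mb)
    (hP : ∀ a g, |P a g| ≤ p0) (hQ : ∀ f h, |Q f h| ≤ q0) (hdF : ∀ i a g, |dF i a g| ≤ p1) (hdG : ∀ j f h, |dG j f h| ≤ q1)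
    (hddF : ∀ i j a g, |ddF i j a g| ≤ p2) (hddG : ∀ i j f h, |ddG i j f h| ≤ q2)
    (eP : ∀ a g, |P a g - P0 a g| ≤ e0) (eQ : ∀ f h, |Q f h - Q0 f h| ≤ f0) (edF : ∀ i a g, |dF i a g - dF0 i a g| ≤ e1)
    (edG : ∀ j f h, |dG j f h - dG0 j f h| ≤ f1) (eddF : ∀ i j a g, |ddF i j a g - ddF0 i j a g| ≤ e2)
    (eddG : ∀ i j f h, |ddG i j f h - ddG0 i j f h| ≤ f2) :
    |leadOf m₀ m₁ P Q dF dG ddF ddG - leadOf m₀ m₁ P0 Q0 dF0 dG0 ddF0 ddG0|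
      ≤ (Fintype.card Φ : ℝ) ^ 4 * (16 * (Mb ^ 2 * ((f0 * p2 + f0 * e2 + q0 * e2) + (e1 * q1 + e1 * f1 + p1 * f1) + (e1 * q1 + e1 * f1 + p1 * f1)
          + (e0 * q2 + e0 * f2 + p0 * f2)))) := by
  set K : ℝ := Mb ^ 2 * ((f0 * p2 + f0 * e2 + q0 * e2) + (e1 * q1 + e1 * f1 + p1 * f1) + (e1 * q1 + e1 * f1 + p1 * f1)
          + (e0 * q2 + e0 * f2 + p0 * f2)) with hK
  -- the bound for one `(i, j)` label pair at one fibre tuple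
  have hij : ∀ (a f g h : Φ) (i j : Idx),
      |(m₀ g f i 0 * m₁ h a j 1 * (Q f h * ddF i j a g) + m₀ g f i 0 * m₁ h a j 0 * (dF i a g * dG j f h)
          + m₀ g f i 1 * m₁ h a j 1 * (dF j a g * dG i f h) + m₀ g f i 1 * m₁ h a j 0 * (P a g * ddG i j f h))
        - (m₀ g f i 0 * m₁ h a j 1 * (Q0 f h * ddF0 i j a g) + m₀ g f i 0 * m₁ h a j 0 * (dF0 i a g * dG0 j f h)
          + m₀ g f i 1 * m₁ h a j 1 * (dF0 j a g * dG0 i f h) + m₀ g f i 1 * m₁ h a j 0 * (P0 a g * ddG0 i j f h))| ≤ K := by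
    intro a f g h i j
    have e : ∀ (t1 t2 t3 t4 s1 s2 s3 s4 : ℝ), (t1 + t2 + t3 + t4) - (s1 + s2 + s3 + s4) = (t1 - s1) + (t2 - s2) + (t3 - s3) + (t4 - s4) :=
      fun _ _ _ _ _ _ _ _ => by ring
    rw [e, hK, mul_add, mul_add, mul_add]
    refine (abs_add_le _ _).trans (add_le_add ((abs_add_le _ _).trans (add_le_add ((abs_add_le _ _).trans (add_le_add ?_ ?_)) ?_)) ?_)
    · exact abs_term_sub_le (hm₀ g f i 0) (hm₁ h a j 1) (hQ f h) (hddF i j a g) (eQ f h) (eddF i j a g)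
    · exact abs_term_sub_le (hm₀ g f i 0) (hm₁ h a j 0) (hdF i a g) (hdG j f h) (edF i a g) (edG j f h)
    · exact abs_term_sub_le (hm₀ g f i 1) (hm₁ h a j 1) (hdF j a g) (hdG i f h) (edF j a g) (edG i f h)
    · exact abs_term_sub_le (hm₀ g f i 1) (hm₁ h a j 0) (hP a g) (hddG i j f h) (eP a g) (eddG i j f h)
  -- one fibre tuple: the two `(i, j)` sums
  have hfib : ∀ a f g h : Φ,
      |(-(∑ i : Idx, ∑ j : Idx, (m₀ g f i 0 * m₁ h a j 1 * (Q f h * ddF i j a g) + m₀ g f i 0 * m₁ h a j 0 * (dF i a g * dG j f h)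
          + m₀ g f i 1 * m₁ h a j 1 * (dF j a g * dG i f h) + m₀ g f i 1 * m₁ h a j 0 * (P a g * ddG i j f h))))
        - (-(∑ i : Idx, ∑ j : Idx, (m₀ g f i 0 * m₁ h a j 1 * (Q0 f h * ddF0 i j a g) + m₀ g f i 0 * m₁ h a j 0 * (dF0 i a g * dG0 j f h)
          + m₀ g f i 1 * m₁ h a j 1 * (dF0 j a g * dG0 i f h) + m₀ g f i 1 * m₁ h a j 0 * (P0 a g * ddG0 i j f h))))| ≤ 4 * (4 * K) := by
    intro a f g h
    rw [neg_sub_neg, abs_sub_comm]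
    refine (abs_fsum_sub_fsum_le _ fun i _ => abs_fsum_sub_fsum_le _ fun j _ => hij a f g h i j).trans (le_of_eq ?_)
    simp [Finset.card_univ]
  unfold leadOf
  refine (abs_fsum_sub_fsum_le _ fun a _ => abs_fsum_sub_fsum_le _ fun f _ => abs_fsum_sub_fsum_le _ fun g _ =>
    abs_fsum_sub_fsum_le _ fun h _ => hfib a f g h).trans (le_of_eq ?_)
  simp only [Finset.card_univ, hK]
  ring

end Estimate

/-! ## §4 The tadpole of a bounded translation-invariant leg against a bi-localised second-order vertex -/

section Tadpole

variable {Φ : Type*} [Fintype Φ] {A W₂ : MKer 4 Φ} {CA Cw δ : ℝ} {z : Pt}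

/-- [folklore] **TADPOLE SIZE** (the engine's single-smear form `TadpoleSmearBridge.tadpole_eq_sum_smear` + the crude smear bound `ExpLocalisedBubbleMarginals.abs_smear_le`):
`|A| ≤ CA`, `A` translation invariant, `BiLoc W₂ 0 z Cw δ`, `δ > 0` ⟹ `|tadpole A W₂| ≤ |Φ|²·(Cw·Θ δ 0·CA)`.  Under the joint-localisation letter (W-loc)
(E-FP-8-1: `Cw := Cw′·e^{−δ|z|₁}`) this is the tadpole's exponential smallness in the bond separation; with a z-free `Cw` it is only `O(1)`. -/
theorem abs_tadpole_le (hδ : 0 < δ) (hA : ∀ x y a b, |A x y a b| ≤ CA) (hT : ∀ v : Pt, shiftK v A = A) (hW : BiLoc W₂ 0 z Cw δ) :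
    |tadpole A W₂| ≤ (Fintype.card Φ : ℝ) ^ 2 * (Cw * Θ δ 0 * CA) := by
  rw [tadpole_eq_sum_smear hδ hA hT hW]
  refine (Finset.abs_sum_le_sum_abs _ _).trans ?_
  calc ∑ a, |∑ f, ∑' p : Pt × Pt, W₂ p.2 (z + p.1) f a * A 0 (-(z + p.1 - p.2)) a f|
      ≤ ∑ _a : Φ, ∑ _f : Φ, Cw * Θ δ 0 * CA :=
        Finset.sum_le_sum fun a _ => (Finset.abs_sum_le_sum_abs _ _).trans (Finset.sum_le_sum fun f _ =>
          abs_smear_le (F := fun v => A 0 (-v) a f) hδ (loc_vertex₂ hW f a) (fun t => hA 0 (-t) a f) z)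
    _ = (Fintype.card Φ : ℝ) ^ 2 * (Cw * Θ δ 0 * CA) := by
        simp only [Finset.sum_const, Finset.card_univ, nsmul_eq_mul]; ring

end Tadpole

/-! ## §5 (v1.1) Bookkeeping and constants for module 2: the `‖z‖∞` currency, the graded sum, the END's constants, the scalar germ bound -/

section Book

open Summit.QuantumFields.BalabanUV.Beta.FP.ExpLocalisedBubbleOrder2Point (Zm K₀ K₁ K₂)
open Summit.QuantumFields.BalabanUV.Beta.FP.GhostCubicGerm (cubicGermOfSc)
open Summit.QuantumFields.BalabanUV.Beta.FP.PolarizationGermBubble (recentre_of_cov recentre_of_cov_sc)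

/-- [folklore] a constant dominating an absolute value through a positive denominator is nonnegative. -/
theorem nonneg_of_abs_le_div {u c d : ℝ} (h : |u| ≤ c / d) (hd : 0 < d) : 0 ≤ c := by
  by_contra hc
  have := div_neg_of_neg_of_pos (lt_of_not_ge hc) hd
  linarith [abs_nonneg u]

/-- [folklore] `(s+1)`-currency to bare `s`-currency (`0 < s`, `0 ≤ c`): `c∕(s+1)^k ≤ c∕s^k`. -/
theorem div_succ_pow_le {c s : ℝ} (hc : 0 ≤ c) (hs : 0 < s) (k : ℕ) : c / (s + 1) ^ k ≤ c / s ^ k :=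
  div_le_div_of_nonneg_left hc (pow_pos hs k) (pow_le_pow_left₀ hs.le (by linarith) k)

/-- [folklore] two graded letters of total degree `≥ 7` multiply to `≤ (product of constants)∕s⁷` (`1 ≤ s`). -/
theorem prod_le_div_pow_seven {a b s : ℝ} {i j : ℕ} (ha : 0 ≤ a) (hb : 0 ≤ b) (hs : 1 ≤ s) (hij : 7 ≤ i + j) :
    a / s ^ i * (b / s ^ j) ≤ a * b / s ^ 7 := by
  rw [div_mul_div_comm, ← pow_add]
  exact div_le_div_of_nonneg_left (mul_nonneg ha hb) (pow_pos (by linarith) 7) (pow_le_pow_right₀ hs hij)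

/-- [our object] THE LEG-REPLACEMENT CONSTANT `Kd = 2·(D₀A₂ + D₀D₂ + A₀D₂) + 2·(D₁A₁ + D₁D₁ + A₁D₁)` (nothing asserted). -/
def Kd (A₀ A₁ A₂ D₀ D₁ D₂ : ℝ) : ℝ := 2 * (D₀ * A₂ + D₀ * D₂ + A₀ * D₂) + 2 * (D₁ * A₁ + D₁ * D₁ + A₁ * D₁)

/-- [folklore] **THE GRADED SUM**: §3's bracket at the graded tables (`p0 = q0 = A₀∕s²`, `p1 = q1 = A₁∕s³`, `p2 = q2 = A₂∕s⁴`, `e0 = f0 = D₀∕s³`, `e1 = f1 = D₁∕s⁴`, `e2 = f2 = D₂∕s⁵`)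
is `≤ Kd∕s⁷` (`1 ≤ s`; every product has total degree 7 or 8). -/
theorem graded_sum_le {A₀ A₁ A₂ D₀ D₁ D₂ s : ℝ} (hA₀ : 0 ≤ A₀) (hA₁ : 0 ≤ A₁) (hA₂ : 0 ≤ A₂) (hD₀ : 0 ≤ D₀) (hD₁ : 0 ≤ D₁) (hD₂ : 0 ≤ D₂)
    (hs : 1 ≤ s) :
    (D₀ / s ^ 3 * (A₂ / s ^ 4) + D₀ / s ^ 3 * (D₂ / s ^ 5) + A₀ / s ^ 2 * (D₂ / s ^ 5))
        + (D₁ / s ^ 4 * (A₁ / s ^ 3) + D₁ / s ^ 4 * (D₁ / s ^ 4) + A₁ / s ^ 3 * (D₁ / s ^ 4))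
        + (D₁ / s ^ 4 * (A₁ / s ^ 3) + D₁ / s ^ 4 * (D₁ / s ^ 4) + A₁ / s ^ 3 * (D₁ / s ^ 4))
        + (D₀ / s ^ 3 * (A₂ / s ^ 4) + D₀ / s ^ 3 * (D₂ / s ^ 5) + A₀ / s ^ 2 * (D₂ / s ^ 5))
      ≤ Kd A₀ A₁ A₂ D₀ D₁ D₂ / s ^ 7 := by
  have t1 := prod_le_div_pow_seven hD₀ hA₂ hs (i := 3) (j := 4) (by norm_num)
  have t2 := prod_le_div_pow_seven hD₀ hD₂ hs (i := 3) (j := 5) (by norm_num)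
  have t3 := prod_le_div_pow_seven hA₀ hD₂ hs (i := 2) (j := 5) (by norm_num)
  have t4 := prod_le_div_pow_seven hD₁ hA₁ hs (i := 4) (j := 3) (by norm_num)
  have t5 := prod_le_div_pow_seven hD₁ hD₁ hs (i := 4) (j := 4) (by norm_num)
  have t6 := prod_le_div_pow_seven hA₁ hD₁ hs (i := 3) (j := 4) (by norm_num)
  have e : Kd A₀ A₁ A₂ D₀ D₁ D₂ / s ^ 7 = (D₀ * A₂ / s ^ 7 + D₀ * D₂ / s ^ 7 + A₀ * D₂ / s ^ 7)
      + (D₁ * A₁ / s ^ 7 + D₁ * D₁ / s ^ 7 + A₁ * D₁ / s ^ 7) + (D₁ * A₁ / s ^ 7 + D₁ * D₁ / s ^ 7 + A₁ * D₁ / s ^ 7)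
      + (D₀ * A₂ / s ^ 7 + D₀ * D₂ / s ^ 7 + A₀ * D₂ / s ^ 7) := by
    unfold Kd; ring
  rw [e]
  linarith

/-- [our object] THE ENGINE'S REMAINDER CONSTANT (`FP/ExpLocalisedBubbleKernel.abs_bubble_kernel_sub_lead_le`, the shape of its `KR`) at degrees `a = b = 2`, equal vertex
constants `Cs` and equal leg letters `(A₀, A₁, A₂, A₃)` for both orientations — written out (nothing asserted). -/
def KR₂ (Cs δ A₀ A₁ A₂ A₃ : ℝ) : ℝ :=
  A₀ * ((Cs * Zl 4 δ) * (Cs * Zl 4 δ) * K₂ δ A₀ A₁ A₂ A₃ 2)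
    + 4 * A₁ * ((Cs * Zm δ 1) * (Cs * Zl 4 δ) * K₁ δ A₀ A₁ A₂ 2 + (Cs * Zl 4 δ) * (Cs * Zm δ 1) * K₁ δ A₀ A₁ A₂ 2)
    + A₀ * ((Cs * Zl 4 δ) * (Cs * Zl 4 δ) * K₂ δ A₀ A₁ A₂ A₃ 2)
    + (Cs * Cs * K₁ δ A₀ A₁ A₂ 2) * K₀ δ A₀ A₁ 2

/-- [our object] THE END'S CONSTANT for a fibre of size `n`: `n⁴·KR₂ + n⁴·16·Mb²·Kd`, `Mb = Cs·(e^{δ∕2}·(2∕δ))·Zl 4 (δ∕2)²` the germ bound of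
`CubicGermFunctional.abs_cubicGermOf_le` (nothing asserted). -/
def Cbub (n : ℕ) (Cs δ A₀ A₁ A₂ A₃ D₀ D₁ D₂ : ℝ) : ℝ :=
  (n : ℝ) ^ 4 * KR₂ Cs δ A₀ A₁ A₂ A₃ + (n : ℝ) ^ 4 * (16 * ((Cs * (Real.exp (δ / 2) * (2 / δ)) * Zl 4 (δ / 2) ^ 2) ^ 2 * Kd A₀ A₁ A₂ D₀ D₁ D₂))

/-- [folklore] **THE SCALAR-FIBRE GERM IS BOUNDED** on bi-localised families: `|cubicGermOfSc v λ κ i| ≤ Cs·(e^{δ∕2}·(2∕δ))·Zl 4 (δ∕2)²` (the `Unit` twin of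
`CubicGermFunctional.abs_cubicGermOf_le`, same route). -/
theorem abs_cubicGermOfSc_le {v : Fin 4 → Site 4 → MKer 4 Unit} {Cs δ : ℝ} (hv : ∀ (lam : Fin 4) (u : Site 4), BiLoc (v lam u) u u Cs δ) (hδ : 0 < δ)
    (lam κ : Fin 4) (i : Fin 2) : |cubicGermOfSc v lam κ i| ≤ Cs * (Real.exp (δ / 2) * (2 / δ)) * Zl 4 (δ / 2) ^ 2 := by
  have h0 : BiLoc (v lam 0) 0 0 Cs δ := hv lam 0
  have hB : BiLoc (fun x y (a b : Unit) => (((if i = 0 then x κ else y κ) : ℤ) : ℝ) * v lam 0 x y a b) 0 0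
      (Cs * (((1 : ℕ).factorial : ℝ) * Real.exp (δ / 2) * (2 / δ) ^ 1)) (δ / 2) := by
    by_cases hi : i = 0
    · simp only [hi, ↓reduceIte]
      exact StencilMoments.biLoc_weight_fst h0 hδ (φ := fun x : Fin 4 → ℤ => ((x κ : ℤ) : ℝ)) (k := 1)
        fun x => CubicGermFunctional.abs_coord_le_l1_add_one x κ
    · simp only [hi, ↓reduceIte]
      exact StencilMoments.biLoc_weight_snd h0 hδ (φ := fun y : Fin 4 → ℤ => ((y κ : ℤ) : ℝ)) (k := 1)
        fun y => CubicGermFunctional.abs_coord_le_l1_add_one y κ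
  have h := CubicGermFunctional.abs_tsum_prod_le_of_biLoc hB (half_pos hδ) () ()
  rw [CubicGermFunctional.germConst_eq] at h
  unfold cubicGermOfSc
  refine le_of_eq_of_le (congrArg _ (tsum_congr fun xz => mul_comm _ _)) h

/-- [folklore] zero total mass survives translation: under (a2) the member at `(ν, z)` has zero total field-block mass in absolute coordinates. -/
theorem tsum_member_eq_zero {V : Fin 4 → Site 4 → MKer 4 (Fib 3)} (hcov : ∀ (lam : Fin 4) (w : Site 4), V lam w = shiftK (-w) (V lam 0))
    (h0 : ∀ (lam α β : Fin 4), ∑' p : Pt × Pt, V lam 0 p.1 p.2 (Sum.inl α) (Sum.inl β) = 0) (ν : Fin 4) (z : Pt) (α β : Fin 4) :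
    ∑' q : Pt × Pt, V ν z q.1 q.2 (Sum.inl α) (Sum.inl β) = 0 := by
  rw [← (Equiv.prodCongr (Equiv.addLeft z) (Equiv.addLeft z)).tsum_eq]
  simp only [Equiv.prodCongr_apply, Equiv.coe_addLeft, Prod.map_fst, Prod.map_snd, recentre_of_cov hcov]
  exact h0 ν α β

/-- [folklore] the same, scalar fibre. -/
theorem tsum_member_eq_zero_sc {v : Fin 4 → Site 4 → MKer 4 Unit} (hcov : ∀ (lam : Fin 4) (w : Site 4), v lam w = shiftK (-w) (v lam 0))
    (h0 : ∀ lam : Fin 4, ∑' p : Pt × Pt, v lam 0 p.1 p.2 () () = 0) (ν : Fin 4) (z : Pt) :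
    ∑' q : Pt × Pt, v ν z q.1 q.2 () () = 0 := by
  rw [← (Equiv.prodCongr (Equiv.addLeft z) (Equiv.addLeft z)).tsum_eq]
  simp only [Equiv.prodCongr_apply, Equiv.coe_addLeft, Prod.map_fst, Prod.map_snd, recentre_of_cov_sc hcov]
  exact h0 ν

end Book


end Summit.QuantumFields.BalabanUV.Beta.FP.PolarizationGermLegs

end
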